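import Mathlib.Analysis.Calculus.MeanValue
import Literature.Probability.RandomPlanarGeometry.SLEHolderDomains
import Literature.Probability.RandomPlanarGeometry.SLEHullBoundaryAreaLargeKappa
import Literature.Probability.RandomPlanarGeometry.RohdeSchrammCor35Proofs
import Literature.Probability.RandomPlanarGeometry.LocalMartingaleProofs
import Literature.Probability.RandomPlanarGeometry.LoewnerScaling
import HarnessLib

/-!
# Hölder continuity of the inverse SLE maps for `κ ≠ 4` (Rohde–Schramm 2005, Thm 5.2), proved

Trunk T-STOCH. Discharge of the named fact
`Literature.Probability.RandomPlanarGeometry.RohdeSchramm2005_thm52` (`SLEHolderDomains.lean`;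
S. Rohde, O. Schramm, *Basic properties of SLE*, Ann. of Math. 161 (2005), Thm. 5.2 = arXiv
math/0106036 Thm. 11): for `κ ∉ {0, 4}` there is `h = h(κ) > 0` such that for every bounded
`A ⊆ ℍ` and every `t`, almost surely `f̂ₜ` is Hölder continuous with exponent `h` on `A`.

We follow the printed proof (p. 901 of the Annals version, p. 12 of the arXiv text) and its
architecture, most of which the tree already holds:

1. *"By scaling, we may assume `0 < t ≤ 1` and `A = [-1, 1] × (0, 1]`"* — Brownian scaling
   `Bₘ = 2⁻ᵐ B(4ᵐ ·)` (Mathlib `IsBrownianReal.smul`) and the scaling rule of the inverse Loewner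
   maps `f^{S_c V}_t(c w) = c f^V_{t/c²}(w)` (`Loewner.loewnerInv_scale`, here `Loewner.fHat_scale`);
   we reduce to `t ≤ 1` and the box `{|re z| ≤ 1, 0 < im z ≤ 1/2}`.
2. *(5.4): a.s. `|f̂ₜ'(z_{j,n})| ≤ C(ω, t) 2^{n(1-h)}` on the grid `z_{j,n} = (j + i)2⁻ⁿ`* — Cor. 3.5
   (`RohdeSchramm2005_cor35`, **proved** in the tree: `RohdeSchramm2005_cor35_holds`) and
   Borel–Cantelli. For `κ ≥ 8` this is already `RohdeSchramm2005_cor35.ae_exists_grid_plane_of_le`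
   (`SLEHullBoundaryAreaLargeKappa`, `b = 7/(2κ)`, `h = 1/40`); for `κ < 8` we use the printed
   choice `b = 1/4 + 1/κ` (then `a - λ = (κ + 4)(κ - 12)/(32κ) < 0`, so `ϑ = 1`, and
   `λ - 1 - 2b = (κ - 4)²/(16κ) > 0` — the only place where `κ ≠ 4` enters) with
   `h(κ) = (κ - 4)²/(2(κ + 4)(κ + 12))`, half the printed bound `(κ - 4)²/((κ + 4)(κ + 12))`
   (`RohdeSchramm2005_cor35.ae_exists_grid_plane_of_lt`).
3. *"From the Koebe distortion Theorem and (5.4) we obtain `|f̂ₜ'(z)| ≤ O(1) C(ω,t) y^{h-1}`"* —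
   `norm_deriv_le_rpow_of_grid` (`SLEHullBoundaryArea`).
4. *"integrating `|f'|` over the hyperbolic geodesic from `z` to `z'` … implies Hölder continuity
   with exponent `h` on `A`"* — the deterministic lemma `holderOnWith_of_norm_deriv_le_rpow` below:
   the two vertical legs by the dyadic Koebe chain `norm_sub_le_rpow_of_deriv` plus one Koebe step,
   the horizontal leg at height `≥ min{|z - z'|, 1/2}` by the mean value inequality on a convex box
   (Mathlib `Convex.norm_image_sub_le_of_norm_deriv_le`).

On the canonical space the driving function is `sleDriving κ ω = √κ · brownian(ω)` and
`Process.brownian` is a Brownian motion with everywhere continuous paths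
(`isBrownianReal_brownian'`, `Process.continuous_brownian`), so the general statement
`ae_exists_holderOnWith_fHat_of_cor35` (any probability space, any Brownian motion with
continuous paths) specialises to `RohdeSchramm2005_thm52_holds`. (Fed into
`RohdeSchramm2005_isHolderDomain_cayley_domain_of_thm52` of `SLEHolderDomainsProofs.lean` — the
passage "(5.1) … `T ∘ fₜ ∘ T⁻¹` is a.s. Hölder continuous in `𝕌`" of the proof of Cor. 5.3 — it
also yields `RohdeSchramm2005_isHolderDomain_cayley_domain`; that one-line corollary is not
recorded here to keep this file independent of that module.) The "moreover" limits of `h(κ)`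
are not part of the named fact and are not addressed.

## References

* S. Rohde, O. Schramm, *Basic properties of SLE*, Ann. of Math. 161 (2005) 883–924, Cor. 3.5,
  Thm. 5.2 and its proof (eq. (5.4)); arXiv:math/0106036, Thm. 11.
* Ch. Pommerenke, *Boundary Behaviour of Conformal Maps* (1992), Thm. 1.3 (Koebe distortion).
* G. F. Lawler, *Conformally Invariant Processes in the Plane*, AMS (2005), Prop. 6.5 (scaling).
-/

noncomputable section

open Set Filter Topology Metric Complex MeasureTheory ProbabilityTheory
open UpperHalfPlane (upperHalfPlaneSet isOpen_upperHalfPlaneSet)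
open scoped NNReal ENNReal

namespace Literature.Probability.RandomPlanarGeometry

open Literature.Analysis.Complex Literature.Analysis.Complex.AreaThm

/-! ### Deterministic: a derivative bound `|f'(x + iy)| ≤ c' y⁻ᵉ` gives Hölder continuity -/

section Deterministic

variable {f : ℂ → ℂ}

/-- A real bound `‖f w - f w'‖ ≤ K d(w, w')^r` on a set is a `HolderOnWith` bound. [folklore] -/
private theorem holderOnWith_of_norm_sub_le {s : Set ℂ} {K r : ℝ≥0}
    (h : ∀ x ∈ s, ∀ y ∈ s, ‖f x - f y‖ ≤ K * dist x y ^ (r : ℝ)) : HolderOnWith K r f s := by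
  intro x hx y hy
  rw [edist_dist, edist_dist, dist_eq_norm]
  refine (ENNReal.ofReal_le_ofReal (h x hx y hy)).trans_eq ?_
  rw [ENNReal.ofReal_mul' (Real.rpow_nonneg dist_nonneg _), ENNReal.ofReal_coe_nnreal]
  congr 1
  exact (ENNReal.ofReal_rpow_of_nonneg dist_nonneg r.2).symm

/-- **Vertical legs of the geodesic.** If `f` is holomorphic and injective on `ℍ` and
`|f'(x + iy)| ≤ c' y⁻ᵉ` for `0 < y ≤ 1` (`0 ≤ e < 1`), then for `0 < y`, `0 < L`, `y + L ≤ 1`,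
`|f(x + i(y + L)) - f(x + iy)| ≤ K L^{1-e}` with `K = 3(2c'/(1 - 2^{e-1}) + 2c') + 4c'`: if
`L ≤ y/2` this is one Koebe growth step (`norm_sub_le_four_mul`, `y⁻ᵉ ≤ L⁻ᵉ`); if `y < 2L`, go down
from `σ = y + L < 3L` along the dyadic heights `σ2⁻ᵏ` to the one in `[y, 2y)`
(`norm_sub_le_rpow_of_deriv`) and finish with one Koebe step (`distortion_upperHalfPlane`).
This is "integrating `|f'|` over the hyperbolic geodesic" of Rohde–Schramm (2005), proof of
Thm. 5.2. [cite: RohdeSchramm2005, Thm 5.2 (proof)] -/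
theorem norm_sub_le_rpow_vertical (hf : DifferentiableOn ℂ f upperHalfPlaneSet)
    (hinj : InjOn f upperHalfPlaneSet) {x c' e : ℝ} (he0 : 0 ≤ e) (he1 : e < 1) (hc' : 0 ≤ c')
    (hder : ∀ y : ℝ, 0 < y → y ≤ 1 → ‖deriv f (x + y * I)‖ ≤ c' * y ^ (-e))
    {y L : ℝ} (hy : 0 < y) (hL : 0 < L) (hyL : y + L ≤ 1) :
    ‖f (x + ((y + L : ℝ) : ℂ) * I) - f (x + y * I)‖ ≤
      (3 * (2 * c' / (1 - (2 : ℝ) ^ (e - 1)) + 2 * c') + 4 * c') * L ^ (1 - e) := by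
  set K₁ : ℝ := 2 * c' / (1 - (2 : ℝ) ^ (e - 1)) with hK₁
  have hρ1 : (2 : ℝ) ^ (e - 1) < 1 := Real.rpow_lt_one_of_one_lt_of_neg one_lt_two (by linarith)
  have hK₁0 : 0 ≤ K₁ := div_nonneg (by positivity) (by linarith)
  have hL1e : 0 ≤ L ^ (1 - e) := Real.rpow_nonneg hL.le _
  rcases le_or_gt L (y / 2) with hLy | hLy
  · -- one Koebe growth step from `x + iy`
    have hz : 0 < ((x : ℂ) + (y : ℂ) * I).im := by simpa using hy
    have hsub : ((x : ℂ) + ((y + L : ℝ) : ℂ) * I) - ((x : ℂ) + (y : ℂ) * I) = ((L : ℝ) : ℂ) * I := by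
      push_cast; ring
    have hnorm : ‖((x : ℂ) + ((y + L : ℝ) : ℂ) * I) - ((x : ℂ) + (y : ℂ) * I)‖ = L := by
      rw [hsub, norm_mul, Complex.norm_I, mul_one, Complex.norm_real, Real.norm_eq_abs, abs_of_pos hL]
    have hdist : ‖((x : ℂ) + ((y + L : ℝ) : ℂ) * I) - ((x : ℂ) + (y : ℂ) * I)‖ ≤
        ((x : ℂ) + (y : ℂ) * I).im / 2 := by
      rw [hnorm]
      simpa using hLy
    have h4 := norm_sub_le_four_mul hf hinj hz hdist
    rw [hnorm] at h4
    have hd := hder y hy (by linarith)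
    have hyL' : y ^ (-e) ≤ L ^ (-e) := Real.rpow_le_rpow_of_nonpos hL (by linarith) (by linarith)
    have hLL : L ^ (-e) * L = L ^ (1 - e) := by
      rw [Real.rpow_sub hL, Real.rpow_one, Real.rpow_neg hL.le, div_eq_mul_inv, mul_comm]
    have h4c : 0 ≤ 4 * c' * L ^ (1 - e) := by positivity
    calc ‖f (x + ((y + L : ℝ) : ℂ) * I) - f (x + y * I)‖ ≤ 4 * ‖deriv f (x + y * I)‖ * L := h4
      _ ≤ 4 * (c' * y ^ (-e)) * L := by gcongr
      _ ≤ 4 * (c' * L ^ (-e)) * L := by gcongr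
      _ = 4 * c' * L ^ (1 - e) := by rw [← hLL]; ring
      _ ≤ (3 * (K₁ + 2 * c') + 4 * c') * L ^ (1 - e) := by
          nlinarith [mul_nonneg (by positivity : (0 : ℝ) ≤ 3 * (K₁ + 2 * c')) hL1e]
  · -- `y < 2L`: dyadic chain from `σ = y + L`, then one Koebe step
    set σ : ℝ := y + L with hσ
    have hσ0 : 0 < σ := by positivity
    have hσ1 : σ ≤ 1 := hyL
    have hσy : 1 ≤ σ / y := by
      rw [le_div_iff₀ hy]
      linarith
    obtain ⟨N, hN1, hN2⟩ := exists_nat_pow_near hσy one_lt_two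
    have hchain := norm_sub_le_rpow_of_deriv hf hinj he1 hder hσ0 hσ1 N
    set τ : ℝ := σ * 2⁻¹ ^ N with hτ
    have hτ0 : 0 < τ := by positivity
    have hyτ : y ≤ τ := by
      have h1 : (2 : ℝ) ^ N * y ≤ σ := (le_div_iff₀ hy).1 hN1
      rw [hτ, inv_pow, ← div_eq_mul_inv, le_div_iff₀ (by positivity)]
      linarith
    have hτy : τ < 2 * y := by
      have h2 : σ < (2 : ℝ) ^ (N + 1) * y := (div_lt_iff₀ hy).1 hN2
      rw [hτ, inv_pow, ← div_eq_mul_inv, div_lt_iff₀ (by positivity)]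
      rw [pow_succ] at h2
      linarith
    have hτσ : τ ≤ σ := by
      rw [hτ]
      exact mul_le_of_le_one_right hσ0.le (pow_le_one₀ (by norm_num) (by norm_num))
    -- the Koebe step from `x + iτ` down to `x + iy`
    have hzτ : 0 < ((x : ℂ) + (τ : ℂ) * I).im := by simpa using hτ0
    have himτ : ((x : ℂ) + (τ : ℂ) * I).im = τ := by simp
    have hdist : ‖((x : ℂ) + (y : ℂ) * I) - ((x : ℂ) + (τ : ℂ) * I)‖ ≤
        ((x : ℂ) + (τ : ℂ) * I).im / 2 := by
      have hsub : ((x : ℂ) + (y : ℂ) * I) - ((x : ℂ) + (τ : ℂ) * I) = ((y - τ : ℝ) : ℂ) * I := by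
        push_cast; ring
      rw [hsub, norm_mul, Complex.norm_I, mul_one, Complex.norm_real, Real.norm_eq_abs, himτ,
        abs_sub_comm, abs_of_nonneg (by linarith)]
      linarith
    obtain ⟨-, -, h3⟩ := distortion_upperHalfPlane hf hinj hzτ hdist
    rw [himτ] at h3
    have hdτ := hder τ hτ0 (hτσ.trans hσ1)
    have hττ : τ * τ ^ (-e) = τ ^ (1 - e) := by
      rw [Real.rpow_sub hτ0, Real.rpow_one, Real.rpow_neg hτ0.le, div_eq_mul_inv]
    have hτσ' : τ ^ (1 - e) ≤ σ ^ (1 - e) := Real.rpow_le_rpow hτ0.le hτσ (by linarith)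
    have hσL : σ ^ (1 - e) ≤ 3 * L ^ (1 - e) := by
      have hσ3 : σ ≤ 3 * L := by rw [hσ]; linarith
      calc σ ^ (1 - e) ≤ (3 * L) ^ (1 - e) := Real.rpow_le_rpow hσ0.le hσ3 (by linarith)
        _ = (3 : ℝ) ^ (1 - e) * L ^ (1 - e) := Real.mul_rpow (by norm_num) hL.le
        _ ≤ 3 * L ^ (1 - e) := by
            gcongr
            calc (3 : ℝ) ^ (1 - e) ≤ (3 : ℝ) ^ (1 : ℝ) :=
                  Real.rpow_le_rpow_of_exponent_le (by norm_num) (by linarith)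
              _ = 3 := Real.rpow_one 3
    have hK0 : 0 ≤ K₁ + 2 * c' := by positivity
    calc ‖f (x + (σ : ℂ) * I) - f (x + y * I)‖
        ≤ ‖f (x + (σ : ℂ) * I) - f (x + (τ : ℂ) * I)‖ + ‖f (x + (τ : ℂ) * I) - f (x + y * I)‖ :=
          norm_sub_le_norm_sub_add_norm_sub _ _ _
      _ ≤ K₁ * σ ^ (1 - e) + 2 * τ * ‖deriv f (x + (τ : ℂ) * I)‖ := by
          refine add_le_add hchain ?_
          rw [norm_sub_rev]
          exact h3
      _ ≤ K₁ * σ ^ (1 - e) + 2 * τ * (c' * τ ^ (-e)) := by gcongr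
      _ = K₁ * σ ^ (1 - e) + 2 * c' * τ ^ (1 - e) := by rw [← hττ]; ring
      _ ≤ K₁ * σ ^ (1 - e) + 2 * c' * σ ^ (1 - e) := by gcongr
      _ = (K₁ + 2 * c') * σ ^ (1 - e) := by ring
      _ ≤ (K₁ + 2 * c') * (3 * L ^ (1 - e)) := by gcongr
      _ = 3 * (K₁ + 2 * c') * L ^ (1 - e) := by ring
      _ ≤ (3 * (K₁ + 2 * c') + 4 * c') * L ^ (1 - e) := by
          nlinarith [mul_nonneg (by positivity : (0 : ℝ) ≤ 4 * c') hL1e]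

/-- **Hölder continuity from the derivative bound** ("It is well-known and easy to see, by
integrating `|f'|` over the hyperbolic geodesic from `z` to `z'` … that this implies Hölder
continuity with exponent `h` on `A`", Rohde–Schramm (2005), end of the proof of Thm. 5.2). If
`f` is holomorphic and injective on `ℍ` and `|f'(x + iy)| ≤ c' y⁻ᵉ` for `|x| ≤ 1`, `0 < y ≤ 1`
(`0 ≤ e < 1`), then `f` is Hölder continuous with exponent `1 - e` on the box
`{|re z| ≤ 1, 0 < im z ≤ 1/2}`: for `z, z'` in the box, `d = |z - z'|`, `L = min{d, 1/2}`, go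
from `z` up to `z + iL`, across to `z' + iL` (a segment in the convex box `{|re| ≤ 1, L ≤ im ≤ 1}`
where `|f'| ≤ c' L⁻ᵉ`, mean value inequality: `≤ c' L⁻ᵉ d ≤ 6c' d^{1-e}`), and down to `z'`
(`norm_sub_le_rpow_vertical`, `≤ K L^{1-e}` each). [cite: RohdeSchramm2005, Thm 5.2 (proof)] -/
theorem holderOnWith_of_norm_deriv_le_rpow (hf : DifferentiableOn ℂ f upperHalfPlaneSet)
    (hinj : InjOn f upperHalfPlaneSet) {c' e : ℝ} (he0 : 0 ≤ e) (he1 : e < 1) (hc' : 0 ≤ c')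
    (hder : ∀ x y : ℝ, |x| ≤ 1 → 0 < y → y ≤ 1 → ‖deriv f (x + y * I)‖ ≤ c' * y ^ (-e)) :
    HolderOnWith
      (Real.toNNReal (2 * (3 * (2 * c' / (1 - (2 : ℝ) ^ (e - 1)) + 2 * c') + 4 * c') + 6 * c'))
      (Real.toNNReal (1 - e)) f {z : ℂ | |z.re| ≤ 1 ∧ 0 < z.im ∧ z.im ≤ 1 / 2} := by
  set Kv : ℝ := 3 * (2 * c' / (1 - (2 : ℝ) ^ (e - 1)) + 2 * c') + 4 * c' with hKv
  have hρ1 : (2 : ℝ) ^ (e - 1) < 1 := Real.rpow_lt_one_of_one_lt_of_neg one_lt_two (by linarith)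
  have hK₁0 : 0 ≤ 2 * c' / (1 - (2 : ℝ) ^ (e - 1)) := div_nonneg (by positivity) (by linarith)
  have hKv0 : 0 ≤ Kv := by positivity
  apply holderOnWith_of_norm_sub_le
  rintro z ⟨hzre, hzim, hzim'⟩ z' ⟨hz're, hz'im, hz'im'⟩
  rw [Real.coe_toNNReal _ (by positivity), Real.coe_toNNReal _ (by linarith)]
  rcases eq_or_ne z z' with rfl | hne
  · rw [sub_self, norm_zero, dist_self, Real.zero_rpow (by linarith), mul_zero]
  set d : ℝ := dist z z' with hd
  have hd0 : 0 < d := dist_pos.2 hne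
  have hd1e : 0 ≤ d ^ (1 - e) := Real.rpow_nonneg hd0.le _
  have hd3 : d ≤ 3 := by
    rw [hd, dist_eq_norm]
    have hre : |(z - z').re| ≤ 2 := by
      rw [Complex.sub_re]
      calc |z.re - z'.re| ≤ |z.re| + |z'.re| := abs_sub _ _
        _ ≤ 2 := by linarith
    have him : |(z - z').im| ≤ 1 / 2 := by
      rw [Complex.sub_im]
      exact abs_le.2 ⟨by linarith, by linarith⟩
    linarith [Complex.norm_le_abs_re_add_abs_im (z - z')]
  set L : ℝ := min d (1 / 2) with hL
  have hL0 : 0 < L := lt_min hd0 (by norm_num)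
  have hLd : L ≤ d := min_le_left _ _
  have hL2 : L ≤ 1 / 2 := min_le_right _ _
  have hL1e : L ^ (1 - e) ≤ d ^ (1 - e) := Real.rpow_le_rpow hL0.le hLd (by linarith)
  -- the lifted points `p₁ = z + iL`, `p₂ = z' + iL`
  set p₁ : ℂ := (z.re : ℂ) + ((z.im + L : ℝ) : ℂ) * I with hp₁
  set p₂ : ℂ := (z'.re : ℂ) + ((z'.im + L : ℝ) : ℂ) * I with hp₂
  -- vertical legs
  have hv₁ : ‖f p₁ - f z‖ ≤ Kv * L ^ (1 - e) := by
    have h := norm_sub_le_rpow_vertical hf hinj he0 he1 hc'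
      (fun s hs0 hs1 ↦ hder z.re s hzre hs0 hs1) hzim hL0 (by linarith)
    rwa [Complex.re_add_im] at h
  have hv₂ : ‖f p₂ - f z'‖ ≤ Kv * L ^ (1 - e) := by
    have h := norm_sub_le_rpow_vertical hf hinj he0 he1 hc'
      (fun s hs0 hs1 ↦ hder z'.re s hz're hs0 hs1) hz'im hL0 (by linarith)
    rwa [Complex.re_add_im] at h
  -- horizontal leg: mean value inequality on the convex box `{|re| ≤ 1, L ≤ im ≤ 1}`
  have hh : ‖f p₂ - f p₁‖ ≤ c' * L ^ (-e) * ‖p₂ - p₁‖ := by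
    set S : Set ℂ := (Complex.reLm ⁻¹' Icc (-1) 1) ∩ (Complex.imLm ⁻¹' Icc L 1) with hS
    have hSconv : Convex ℝ S :=
      ((convex_Icc (-1 : ℝ) 1).linear_preimage Complex.reLm).inter
        ((convex_Icc L 1).linear_preimage Complex.imLm)
    have hmemS : ∀ w : ℂ, w ∈ S ↔ |w.re| ≤ 1 ∧ L ≤ w.im ∧ w.im ≤ 1 := by
      intro w
      simp only [hS, mem_inter_iff, mem_preimage, mem_Icc, Complex.reLm_coe, Complex.imLm_coe,
        abs_le]
    have hdiff : ∀ w ∈ S, DifferentiableAt ℂ f w := fun w hw ↦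
      hf.differentiableAt (isOpen_upperHalfPlaneSet.mem_nhds
        (show 0 < w.im from hL0.trans_le ((hmemS w).1 hw).2.1))
    have hbound : ∀ w ∈ S, ‖deriv f w‖ ≤ c' * L ^ (-e) := by
      intro w hw
      obtain ⟨hwre, hwL, hw1⟩ := (hmemS w).1 hw
      have hw0 : 0 < w.im := hL0.trans_le hwL
      have h1 := hder w.re w.im hwre hw0 hw1
      rw [Complex.re_add_im] at h1
      calc ‖deriv f w‖ ≤ c' * w.im ^ (-e) := h1
        _ ≤ c' * L ^ (-e) :=
            mul_le_mul_of_nonneg_left (Real.rpow_le_rpow_of_nonpos hL0 hwL (by linarith)) hc'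
    have hp₁re : p₁.re = z.re := by simp [hp₁]
    have hp₁im : p₁.im = z.im + L := by simp [hp₁]
    have hp₂re : p₂.re = z'.re := by simp [hp₂]
    have hp₂im : p₂.im = z'.im + L := by simp [hp₂]
    have hp₁S : p₁ ∈ S := (hmemS p₁).2
      ⟨by rw [hp₁re]; exact hzre, by rw [hp₁im]; linarith, by rw [hp₁im]; linarith⟩
    have hp₂S : p₂ ∈ S := (hmemS p₂).2
      ⟨by rw [hp₂re]; exact hz're, by rw [hp₂im]; linarith, by rw [hp₂im]; linarith⟩
    exact hSconv.norm_image_sub_le_of_norm_deriv_le hdiff hbound hp₁S hp₂S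
  have hp : p₂ - p₁ = z' - z := Complex.ext (by simp [hp₁, hp₂]) (by simp [hp₁, hp₂])
  have hpd : ‖p₂ - p₁‖ = d := by rw [hp, hd, dist_comm, dist_eq_norm]
  -- `L⁻ᵉ d ≤ 6 d^{1-e}`
  have hkey : L ^ (-e) * d ≤ 6 * d ^ (1 - e) := by
    rcases le_or_gt d (1 / 2) with hdl | hdl
    · have hLd' : L = d := min_eq_left hdl
      have h1 : L ^ (-e) * d = d ^ (1 - e) := by
        rw [hLd', Real.rpow_sub hd0, Real.rpow_one, Real.rpow_neg hd0.le, div_eq_mul_inv, mul_comm]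
      rw [h1]
      linarith
    · have hL' : L = 1 / 2 := min_eq_right hdl.le
      have h1 : L ^ (-e) ≤ 2 := by
        rw [hL', Real.rpow_neg (by norm_num), ← Real.inv_rpow (by norm_num), one_div, inv_inv]
        calc (2 : ℝ) ^ e ≤ (2 : ℝ) ^ (1 : ℝ) := Real.rpow_le_rpow_of_exponent_le one_le_two he1.le
          _ = 2 := Real.rpow_one 2
      have h2 : d ≤ 3 * d ^ (1 - e) := by
        have h3 : d = d ^ e * d ^ (1 - e) := by
          rw [← Real.rpow_add hd0]
          norm_num
        have h4 : d ^ e ≤ 3 :=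
          calc d ^ e ≤ (3 : ℝ) ^ e := Real.rpow_le_rpow hd0.le hd3 he0
            _ ≤ (3 : ℝ) ^ (1 : ℝ) := Real.rpow_le_rpow_of_exponent_le (by norm_num) he1.le
            _ = 3 := Real.rpow_one 3
        calc d = d ^ e * d ^ (1 - e) := h3
          _ ≤ 3 * d ^ (1 - e) := by gcongr
      calc L ^ (-e) * d ≤ 2 * (3 * d ^ (1 - e)) :=
            mul_le_mul h1 h2 hd0.le (by norm_num)
        _ = 6 * d ^ (1 - e) := by ring
  -- assembling the three legs
  calc ‖f z - f z'‖ ≤ ‖f z - f p₁‖ + ‖f p₁ - f z'‖ := norm_sub_le_norm_sub_add_norm_sub _ _ _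
    _ ≤ ‖f z - f p₁‖ + (‖f p₁ - f p₂‖ + ‖f p₂ - f z'‖) := by
        gcongr
        exact norm_sub_le_norm_sub_add_norm_sub _ _ _
    _ ≤ Kv * L ^ (1 - e) + (c' * L ^ (-e) * ‖p₂ - p₁‖ + Kv * L ^ (1 - e)) := by
        rw [norm_sub_rev (f z) (f p₁), norm_sub_rev (f p₁) (f p₂)]
        exact add_le_add hv₁ (add_le_add hh hv₂)
    _ = 2 * Kv * L ^ (1 - e) + c' * (L ^ (-e) * d) := by rw [hpd]; ring
    _ ≤ 2 * Kv * d ^ (1 - e) + c' * (6 * d ^ (1 - e)) := by gcongr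
    _ = (2 * Kv + 6 * c') * d ^ (1 - e) := by ring

end Deterministic

/-! ### Exponent bookkeeping for the printed choice `b = 1/4 + 1/κ` (`κ < 12`) -/

/-- `λ(κ, 1/4 + 1/κ) = (κ + 4)(κ + 12)/(16κ)`. [cite: RohdeSchramm2005, Thm 5.2 (proof)] -/
theorem expLam_quarter_add_inv {κ : ℝ} (hκ : κ ≠ 0) :
    RohdeSchramm.expLam κ (1 / 4 + 1 / κ) = (κ + 4) * (κ + 12) / (16 * κ) := by
  rw [RohdeSchramm.expLam]
  field_simp
  ring

/-- `a(κ, 1/4 + 1/κ) - λ(κ, 1/4 + 1/κ) = (κ + 4)(κ - 12)/(32κ)`, negative for `κ < 12` (so that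
`ϑ = 1` in Cor. 3.5: "If `0 < κ ≤ 12`, `b = 1/4 + 1/κ` … the first condition is satisfied").
[cite: RohdeSchramm2005, Thm 5.2 (proof)] -/
theorem expA_sub_expLam_quarter_add_inv {κ : ℝ} (hκ : κ ≠ 0) :
    RohdeSchramm.expA κ (1 / 4 + 1 / κ) - RohdeSchramm.expLam κ (1 / 4 + 1 / κ) =
      (κ + 4) * (κ - 12) / (32 * κ) := by
  rw [RohdeSchramm.expA, RohdeSchramm.expLam]
  field_simp
  ring

/-- For `0 < κ < 12`: `a - λ < 0` at `b = 1/4 + 1/κ`. [cite: RohdeSchramm2005, Thm 5.2 (proof)] -/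
theorem expA_sub_expLam_quarter_add_inv_neg {κ : ℝ} (hκ : 0 < κ) (h12 : κ < 12) :
    RohdeSchramm.expA κ (1 / 4 + 1 / κ) - RohdeSchramm.expLam κ (1 / 4 + 1 / κ) < 0 := by
  rw [expA_sub_expLam_quarter_add_inv hκ.ne']
  exact div_neg_of_neg_of_pos (mul_neg_of_pos_of_neg (by linarith) (by linarith)) (by positivity)

/-- The level exponent of the Borel–Cantelli sum with `b = 1/4 + 1/κ` and Hölder exponent
`h = (κ - 4)²/(2(κ + 4)(κ + 12))`: `1 + 2b - (1 - h)λ = -(κ - 4)²/(32κ) < 0` for `κ ∉ {0, 4}`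
(the printed condition "`1 + 2b - (1 - h)λ < 0`", where `λ - 1 - 2b = (κ - 4)²/(16κ)`).
[cite: RohdeSchramm2005, Thm 5.2 (proof)] -/
theorem one_add_gridExp_quarter_lt {κ : ℝ} (hκ : 0 < κ) (h4 : κ ≠ 4) :
    1 + (1 / 2 + 2 / κ - (1 - (κ - 4) ^ 2 / (2 * (κ + 4) * (κ + 12))) *
      ((κ + 4) * (κ + 12) / (16 * κ))) < 0 := by
  have h1 : 1 + (1 / 2 + 2 / κ - (1 - (κ - 4) ^ 2 / (2 * (κ + 4) * (κ + 12))) *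
      ((κ + 4) * (κ + 12) / (16 * κ))) = -((κ - 4) ^ 2 / (32 * κ)) := by
    field_simp
    ring
  rw [h1, neg_lt_zero]
  have h2 : (κ - 4) ^ 2 ≠ 0 := pow_ne_zero 2 (sub_ne_zero.2 h4)
  positivity

/-- `0 < h(κ) = (κ - 4)²/(2(κ + 4)(κ + 12)) < 1` for `κ > 0`, `κ ≠ 4`. [folklore] -/
theorem holderExp_quarter_pos_lt_one {κ : ℝ} (hκ : 0 < κ) (h4 : κ ≠ 4) :
    0 < (κ - 4) ^ 2 / (2 * (κ + 4) * (κ + 12)) ∧ (κ - 4) ^ 2 / (2 * (κ + 4) * (κ + 12)) < 1 := by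
  have h2 : (κ - 4) ^ 2 ≠ 0 := pow_ne_zero 2 (sub_ne_zero.2 h4)
  refine ⟨by positivity, ?_⟩
  rw [div_lt_one (by positivity)]
  nlinarith

/-! ### Probabilistic: (5.4) on the planar dyadic grid for `κ < 12`, from Cor. 3.5 -/

section Grid

variable {Ω : Type*} [MeasurableSpace Ω] {P : Measure Ω}

/-- **The one-point bound on the planar grid, `κ < 12`** (Cor. 3.5 with the printed
`b = 1/4 + 1/κ` at `z_{j,n} = (j + i)/N`, `N = 2ⁿ`, `δ = N⁻ʰ`, `0 < h`): for `t ≤ 1` and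
`|j| ≤ R N`, `P[|f̂ₜ'(z_{j,n})| ≥ N^{1-h}] ≤ C (1 + R²)ᵇ N^{2b - (1-h)λ}` (`ϑ = 1` as `a < λ`).
[cite: RohdeSchramm2005, Thm 5.2 (proof, (5.4))] -/
theorem RohdeSchramm2005_cor35.measure_grid_plane_le_of_lt {κ : ℝ≥0} (hκ : κ ≠ 0)
    (h12 : (κ : ℝ) < 12) {h : ℝ} (hh0 : 0 ≤ h) {C : ℝ}
    (hC : ∀ (B : ℝ≥0 → Ω → ℝ), IsBrownianReal B P → (∀ ω, Continuous (B · ω)) →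
      ∀ (t : ℝ≥0), t ≤ 1 → ∀ (x y δ : ℝ), 0 < y → y ≤ 1 → 0 < δ → δ ≤ 1 →
        P {ω | δ / y ≤ ‖deriv (Loewner.fHat (fun s ↦ Real.sqrt κ * B s ω) t) (x + I * y)‖} ≤
          ENNReal.ofReal (C * (1 + x ^ 2 / y ^ 2) ^ (1 / 4 + 1 / (κ : ℝ)) *
            (y / δ) ^ RohdeSchramm.expLam κ (1 / 4 + 1 / (κ : ℝ)) *
            RohdeSchramm.theta δ (RohdeSchramm.expA κ (1 / 4 + 1 / (κ : ℝ)) -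
              RohdeSchramm.expLam κ (1 / 4 + 1 / (κ : ℝ)))))
    {B : ℝ≥0 → Ω → ℝ} (hB : IsBrownianReal B P) (hBc : ∀ ω, Continuous (B · ω))
    {t : ℝ≥0} (ht : t ≤ 1) (R n : ℕ) {j : ℤ} (hj : |(j : ℝ)| ≤ R * 2 ^ n) :
    P {ω | ((2 : ℝ) ^ n) ^ (1 - h) ≤
        ‖deriv (Loewner.fHat (fun s ↦ Real.sqrt κ * B s ω) t)
          (↑((j : ℝ) * ((2 : ℝ) ^ n)⁻¹) + I * ↑(((2 : ℝ) ^ n)⁻¹))‖} ≤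
      ENNReal.ofReal (max C 0 * (1 + (R : ℝ) ^ 2) ^ (1 / 4 + 1 / (κ : ℝ)) *
        ((2 : ℝ) ^ n) ^ (1 / 2 + 2 / (κ : ℝ) - (1 - h) * (((κ : ℝ) + 4) * ((κ : ℝ) + 12) / (16 * (κ : ℝ))))) := by
  have hκ0 : (0 : ℝ) < κ := by exact_mod_cast pos_iff_ne_zero.2 hκ
  have hb0 : (0 : ℝ) ≤ 1 / 4 + 1 / (κ : ℝ) := by positivity
  set N : ℝ := (2 : ℝ) ^ n with hN_def
  have hN0 : 0 < N := by positivity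
  have hN1 : 1 ≤ N := one_le_pow₀ one_le_two
  set δ : ℝ := N ^ (-h) with hδ_def
  have hδ0 : 0 < δ := Real.rpow_pos_of_pos hN0 _
  have hδ1 : δ ≤ 1 := Real.rpow_le_one_of_one_le_of_nonpos hN1 (by linarith)
  have hy0 : 0 < N⁻¹ := inv_pos.2 hN0
  have hy1 : N⁻¹ ≤ 1 := inv_le_one_of_one_le₀ hN1
  have hthr : δ / N⁻¹ = N ^ (1 - h) := by
    rw [hδ_def, div_inv_eq_mul, ← Real.rpow_add_one hN0.ne']
    congr 1
    ring
  have hP := hC B hB hBc t ht ((j : ℝ) * N⁻¹) N⁻¹ δ hy0 hy1 hδ0 hδ1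
  rw [hthr] at hP
  refine hP.trans (ENNReal.ofReal_le_ofReal ?_)
  rw [RohdeSchramm.theta_of_neg _ (expA_sub_expLam_quarter_add_inv_neg hκ0 h12), mul_one,
    expLam_quarter_add_inv hκ0.ne']
  have hx : 1 + ((j : ℝ) * N⁻¹) ^ 2 / N⁻¹ ^ 2 = 1 + (j : ℝ) ^ 2 := by
    field_simp
  have hratio : N⁻¹ / δ = N ^ (-(1 - h)) := by
    rw [hδ_def, ← Real.rpow_neg_one, ← Real.rpow_sub hN0]
    congr 1
    ring
  have hpow1 : (N ^ (-(1 - h))) ^ (((κ : ℝ) + 4) * ((κ : ℝ) + 12) / (16 * (κ : ℝ))) =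
      N ^ (-(1 - h) * (((κ : ℝ) + 4) * ((κ : ℝ) + 12) / (16 * (κ : ℝ)))) := by
    rw [← Real.rpow_mul hN0.le]
  rw [hx, hratio, hpow1]
  -- `(1 + j²)^b ≤ (1 + R²)^b N^{2b}`, `2b = 1/2 + 2/κ`
  have hj2 : (j : ℝ) ^ 2 ≤ (R : ℝ) ^ 2 * N ^ 2 := by
    rw [← sq_abs (j : ℝ)]
    have h0 : 0 ≤ |(j : ℝ)| := abs_nonneg _
    calc |(j : ℝ)| ^ 2 ≤ ((R : ℝ) * N) ^ 2 := by gcongr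
      _ = (R : ℝ) ^ 2 * N ^ 2 := by ring
  have hbase : 1 + (j : ℝ) ^ 2 ≤ (1 + (R : ℝ) ^ 2) * N ^ 2 := by
    have : (1 : ℝ) ≤ N ^ 2 := one_le_pow₀ hN1
    nlinarith
  have h2b : ((2 : ℕ) : ℝ) * (1 / 4 + 1 / (κ : ℝ)) = 1 / 2 + 2 / (κ : ℝ) := by
    push_cast
    field_simp
    ring
  have hb : (1 + (j : ℝ) ^ 2) ^ (1 / 4 + 1 / (κ : ℝ)) ≤
      (1 + (R : ℝ) ^ 2) ^ (1 / 4 + 1 / (κ : ℝ)) * N ^ (1 / 2 + 2 / (κ : ℝ)) := by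
    calc (1 + (j : ℝ) ^ 2) ^ (1 / 4 + 1 / (κ : ℝ))
        ≤ ((1 + (R : ℝ) ^ 2) * N ^ 2) ^ (1 / 4 + 1 / (κ : ℝ)) :=
          Real.rpow_le_rpow (by positivity) hbase hb0
      _ = (1 + (R : ℝ) ^ 2) ^ (1 / 4 + 1 / (κ : ℝ)) * (N ^ 2) ^ (1 / 4 + 1 / (κ : ℝ)) :=
          Real.mul_rpow (by positivity) (by positivity)
      _ = (1 + (R : ℝ) ^ 2) ^ (1 / 4 + 1 / (κ : ℝ)) * N ^ (1 / 2 + 2 / (κ : ℝ)) := by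
          rw [← Real.rpow_natCast_mul hN0.le, h2b]
  have hprod : N ^ (1 / 2 + 2 / (κ : ℝ)) * N ^ (-(1 - h) * (((κ : ℝ) + 4) * ((κ : ℝ) + 12) / (16 * (κ : ℝ)))) =
      N ^ (1 / 2 + 2 / (κ : ℝ) - (1 - h) * (((κ : ℝ) + 4) * ((κ : ℝ) + 12) / (16 * (κ : ℝ)))) := by
    rw [← Real.rpow_add hN0]
    congr 1
    ring
  calc C * (1 + (j : ℝ) ^ 2) ^ (1 / 4 + 1 / (κ : ℝ)) *
        N ^ (-(1 - h) * (((κ : ℝ) + 4) * ((κ : ℝ) + 12) / (16 * (κ : ℝ))))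
      ≤ max C 0 * (1 + (j : ℝ) ^ 2) ^ (1 / 4 + 1 / (κ : ℝ)) *
          N ^ (-(1 - h) * (((κ : ℝ) + 4) * ((κ : ℝ) + 12) / (16 * (κ : ℝ)))) := by
        gcongr
        exact le_max_left _ _
    _ ≤ max C 0 * ((1 + (R : ℝ) ^ 2) ^ (1 / 4 + 1 / (κ : ℝ)) * N ^ (1 / 2 + 2 / (κ : ℝ))) *
          N ^ (-(1 - h) * (((κ : ℝ) + 4) * ((κ : ℝ) + 12) / (16 * (κ : ℝ)))) := by
        gcongr
    _ = max C 0 * (1 + (R : ℝ) ^ 2) ^ (1 / 4 + 1 / (κ : ℝ)) *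
          (N ^ (1 / 2 + 2 / (κ : ℝ)) *
            N ^ (-(1 - h) * (((κ : ℝ) + 4) * ((κ : ℝ) + 12) / (16 * (κ : ℝ))))) := by ring
    _ = max C 0 * (1 + (R : ℝ) ^ 2) ^ (1 / 4 + 1 / (κ : ℝ)) *
          N ^ (1 / 2 + 2 / (κ : ℝ) - (1 - h) * (((κ : ℝ) + 4) * ((κ : ℝ) + 12) / (16 * (κ : ℝ)))) := by
        rw [hprod]

/-- **(5.4) on the planar dyadic grid, `κ < 12`, `κ ∉ {0, 4}`, almost surely** (Borel–Cantelli on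
`RohdeSchramm2005_cor35.measure_grid_plane_le_of_lt`): for a Brownian motion `B` with continuous
paths, `t ≤ 1` and `R ∈ ℕ`, almost surely there is `c` with
`|f̂ₜ'((j + i) 2⁻ⁿ)| ≤ c (2ⁿ)^{1 - h(κ)}`, `h(κ) = (κ - 4)²/(2(κ + 4)(κ + 12))`, for all `n ∈ ℕ` and
all integers `|j| ≤ R 2ⁿ` (the `(2R + 1)2ⁿ` bad events at level `n` have total probability
`≤ K_R (2ⁿ)^{1 + 2b - (1-h)λ}`, `1 + 2b - (1 - h)λ = -(κ - 4)²/(32κ) < 0`, a summable geometric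
series; the finitely many exceptional levels are absorbed into `c`). Rohde–Schramm (2005), proof
of Thm. 5.2, eq. (5.4) with `b = 1/4 + 1/κ`. [cite: RohdeSchramm2005, Thm 5.2 (proof, (5.4))] -/
theorem RohdeSchramm2005_cor35.ae_exists_grid_plane_of_lt (h35 : RohdeSchramm2005_cor35 P)
    {κ : ℝ≥0} (hκ : κ ≠ 0) (h4 : κ ≠ 4) (h12 : (κ : ℝ) < 12)
    {B : ℝ≥0 → Ω → ℝ} (hB : IsBrownianReal B P) (hBc : ∀ ω, Continuous (B · ω))
    {t : ℝ≥0} (ht : t ≤ 1) (R : ℕ) :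
    ∀ᵐ ω ∂P, ∃ c : ℝ, ∀ (n : ℕ) (j : ℤ), |(j : ℝ)| ≤ R * 2 ^ n →
      ‖deriv (Loewner.fHat (fun s ↦ Real.sqrt κ * B s ω) t)
        (↑((j : ℝ) * ((2 : ℝ) ^ n)⁻¹) + I * ↑(((2 : ℝ) ^ n)⁻¹))‖ ≤
        c * ((2 : ℝ) ^ n) ^ (1 - ((κ : ℝ) - 4) ^ 2 / (2 * ((κ : ℝ) + 4) * ((κ : ℝ) + 12))) := by
  have hκR : (0 : ℝ) < κ := by exact_mod_cast pos_iff_ne_zero.2 hκ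
  have h4R : (κ : ℝ) ≠ 4 := by exact_mod_cast h4
  set hκ' : ℝ := ((κ : ℝ) - 4) ^ 2 / (2 * ((κ : ℝ) + 4) * ((κ : ℝ) + 12)) with hhκ
  obtain ⟨hh0, hh1⟩ := holderExp_quarter_pos_lt_one hκR h4R
  set E : ℝ := 1 / 2 + 2 / (κ : ℝ) - (1 - hκ') * (((κ : ℝ) + 4) * ((κ : ℝ) + 12) / (16 * (κ : ℝ)))
    with hE
  have hE1 : 1 + E < 0 := one_add_gridExp_quarter_lt hκR h4R
  obtain ⟨C, hC⟩ := h35 κ hκ (1 / 4 + 1 / (κ : ℝ)) (by positivity) (by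
    have h1 : (0 : ℝ) < 1 / (κ : ℝ) := by positivity
    have h2 : (4 : ℝ) / (κ : ℝ) = 4 * (1 / (κ : ℝ)) := by ring
    linarith)
  -- the grid values and the bad events
  set D : Ω → ℕ → ℤ → ℝ := fun ω n j ↦
    ‖deriv (Loewner.fHat (fun s ↦ Real.sqrt κ * B s ω) t)
      (↑((j : ℝ) * ((2 : ℝ) ^ n)⁻¹) + I * ↑(((2 : ℝ) ^ n)⁻¹))‖ with hD
  set J : ℕ → Finset ℤ := fun n ↦ Finset.Icc (-((R * 2 ^ n : ℕ) : ℤ)) ((R * 2 ^ n : ℕ) : ℤ) with hJ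
  have hJmem : ∀ (n : ℕ) (j : ℤ), j ∈ J n ↔ |(j : ℝ)| ≤ R * 2 ^ n := by
    intro n j
    rw [hJ, Finset.mem_Icc, ← Int.cast_abs, show (R : ℝ) * 2 ^ n = ((R * 2 ^ n : ℕ) : ℤ) by
      push_cast; ring, Int.cast_le, abs_le]
  have hJcard : ∀ n : ℕ, ((J n).card : ℝ) ≤ (2 * R + 1) * 2 ^ n := by
    intro n
    rw [hJ, Int.card_Icc, show ((R * 2 ^ n : ℕ) : ℤ) + 1 - -((R * 2 ^ n : ℕ) : ℤ) =
      ((2 * (R * 2 ^ n) + 1 : ℕ) : ℤ) by push_cast; ring, Int.toNat_natCast]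
    have : (1 : ℝ) ≤ 2 ^ n := one_le_pow₀ one_le_two
    push_cast
    nlinarith
  set A : ℕ → Set Ω := fun n ↦ ⋃ j ∈ J n, {ω | ((2 : ℝ) ^ n) ^ (1 - hκ') ≤ D ω n j} with hA
  set K : ℝ := max C 0 * (1 + (R : ℝ) ^ 2) ^ (1 / 4 + 1 / (κ : ℝ)) with hK
  have hK0 : 0 ≤ K := mul_nonneg (le_max_right _ _) (Real.rpow_nonneg (by positivity) _)
  set r : ℝ := (2 : ℝ) ^ (1 + E) with hr
  have hr0 : 0 ≤ r := Real.rpow_nonneg zero_le_two _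
  have hr1 : r < 1 := Real.rpow_lt_one_of_one_lt_of_neg one_lt_two hE1
  have hbound : ∀ n, P (A n) ≤ ENNReal.ofReal ((2 * R + 1) * K * r ^ n) := by
    intro n
    have hN0 : (0 : ℝ) < 2 ^ n := by positivity
    calc P (A n) ≤ ∑ j ∈ J n, P {ω | ((2 : ℝ) ^ n) ^ (1 - hκ') ≤ D ω n j} :=
          measure_biUnion_finset_le _ _
      _ ≤ ∑ _j ∈ J n, ENNReal.ofReal (K * ((2 : ℝ) ^ n) ^ E) :=
          Finset.sum_le_sum fun j hj ↦
            RohdeSchramm2005_cor35.measure_grid_plane_le_of_lt hκ h12 hh0.le hC hB hBc ht R n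
              ((hJmem n j).1 hj)
      _ = ENNReal.ofReal ((J n).card * (K * ((2 : ℝ) ^ n) ^ E)) := by
          rw [Finset.sum_const, nsmul_eq_mul, ENNReal.ofReal_mul (Nat.cast_nonneg _),
            ENNReal.ofReal_natCast]
      _ ≤ ENNReal.ofReal ((2 * R + 1) * 2 ^ n * (K * ((2 : ℝ) ^ n) ^ E)) := by
          apply ENNReal.ofReal_le_ofReal
          have : 0 ≤ K * ((2 : ℝ) ^ n) ^ E := mul_nonneg hK0 (Real.rpow_nonneg hN0.le _)
          exact mul_le_mul_of_nonneg_right (hJcard n) this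
      _ = ENNReal.ofReal ((2 * R + 1) * K * r ^ n) := by
          rw [hr, ← two_pow_mul_rpow E n]; ring_nf
  have hsum : ∑' n, P (A n) ≠ ∞ := by
    refine ne_top_of_le_ne_top ?_ (ENNReal.tsum_le_tsum hbound)
    have hnn : ∀ n : ℕ, 0 ≤ (2 * R + 1) * K * r ^ n := fun n ↦ by positivity
    rw [← ENNReal.ofReal_tsum_of_nonneg hnn
      (((summable_geometric_of_lt_one hr0 hr1).mul_left ((2 * R + 1) * K)))]
    exact ENNReal.ofReal_ne_top
  filter_upwards [ae_eventually_notMem hsum] with ω hω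
  obtain ⟨n₀, hn₀⟩ := eventually_atTop.1 hω
  have hgood : ∀ n, n₀ ≤ n → ∀ j ∈ J n, D ω n j < ((2 : ℝ) ^ n) ^ (1 - hκ') := by
    intro n hn j hj
    have := hn₀ n hn
    simp only [hA, mem_iUnion, mem_setOf_eq, not_exists, not_le, exists_prop, not_and] at this
    exact this j hj
  -- absorb the finitely many levels `n < n₀`
  have hD0 : ∀ n j, 0 ≤ D ω n j := fun n j ↦ norm_nonneg _
  obtain ⟨M, hM0, hMle⟩ : ∃ M : ℝ, 0 ≤ M ∧ ∀ n j, n < n₀ → j ∈ J n → D ω n j ≤ M := by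
    refine ⟨∑ n ∈ Finset.range n₀, ∑ j ∈ J n, D ω n j,
      Finset.sum_nonneg fun n _ ↦ Finset.sum_nonneg fun j _ ↦ hD0 n j, fun n j hn hj ↦ ?_⟩
    calc D ω n j ≤ ∑ j' ∈ J n, D ω n j' :=
          Finset.single_le_sum (f := fun j' ↦ D ω n j') (fun j' _ ↦ hD0 n j') hj
      _ ≤ ∑ n' ∈ Finset.range n₀, ∑ j' ∈ J n', D ω n' j' :=
          Finset.single_le_sum (f := fun n' ↦ ∑ j' ∈ J n', D ω n' j')
            (fun n' _ ↦ Finset.sum_nonneg fun j' _ ↦ hD0 n' j') (Finset.mem_range.2 hn)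
  have hpow : ∀ n : ℕ, 1 ≤ ((2 : ℝ) ^ n) ^ (1 - hκ') := fun n ↦
    Real.one_le_rpow (one_le_pow₀ one_le_two) (by linarith)
  refine ⟨max 1 M, fun n j hj ↦ ?_⟩
  have hjJ : j ∈ J n := (hJmem n j).2 hj
  show D ω n j ≤ max 1 M * ((2 : ℝ) ^ n) ^ (1 - hκ')
  rcases lt_or_ge n n₀ with hn | hn
  · calc D ω n j ≤ M := hMle n j hn hjJ
      _ ≤ max 1 M * 1 := by rw [mul_one]; exact le_max_right _ _
      _ ≤ max 1 M * ((2 : ℝ) ^ n) ^ (1 - hκ') :=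
          mul_le_mul_of_nonneg_left (hpow n) (le_trans zero_le_one (le_max_left _ _))
  · calc D ω n j ≤ ((2 : ℝ) ^ n) ^ (1 - hκ') := (hgood n hn j hjJ).le
      _ = 1 * ((2 : ℝ) ^ n) ^ (1 - hκ') := (one_mul _).symm
      _ ≤ max 1 M * ((2 : ℝ) ^ n) ^ (1 - hκ') :=
          mul_le_mul_of_nonneg_right (le_max_left _ _) (Real.rpow_nonneg (by positivity) _)

end Grid

/-! ### Scaling of `f̂ₜ` and transfer of Hölder bounds -/

namespace Loewner

variable {W V : ℝ≥0 → ℝ}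

/-- **Scaling of `f̂ₜ`**: for the rescaled driving function `S_c V = (s ↦ c V(s/c²))`, `c > 0`, and
`z ∈ ℍ`, `f̂^{S_c V}_t(z) = c f̂^V_{t/c²}(z/c)` (from `f^{S_c V}_t(c w) = c f^V_{t/c²}(w)`,
`loewnerInv_scale`, at `w = V(t/c²) + z/c`). Rohde–Schramm (2005), Prop. 2.1 (i) and proof of
Thm. 5.2 ("By scaling"). [cite: RohdeSchramm2005, Prop. 2.1] -/
theorem fHat_scale (hV : Continuous V) {c : ℝ≥0} (hc : c ≠ 0) (t : ℝ≥0) {z : ℂ} (hz : 0 < z.im) :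
    fHat (fun s ↦ (c : ℝ) * V (s / c ^ 2)) t z =
      ((c : ℝ) : ℂ) * fHat V (t / c ^ 2) (z / ((c : ℝ) : ℂ)) := by
  have hc' : (0 : ℝ) < c := NNReal.coe_pos.2 (pos_iff_ne_zero.2 hc)
  have hcc : ((c : ℝ) : ℂ) ≠ 0 := by exact_mod_cast hc'.ne'
  have him : 0 < ((V (t / c ^ 2) : ℂ) + z / ((c : ℝ) : ℂ)).im := by
    rw [Complex.add_im, Complex.ofReal_im, zero_add, Complex.div_ofReal_im]
    exact div_pos hz hc'
  change loewnerInv (fun s ↦ (c : ℝ) * V (s / c ^ 2)) t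
      ((((c : ℝ) * V (t / c ^ 2) : ℝ) : ℂ) + z) =
    ((c : ℝ) : ℂ) * loewnerInv V (t / c ^ 2) ((V (t / c ^ 2) : ℂ) + z / ((c : ℝ) : ℂ))
  have hpt : (((c : ℝ) * V (t / c ^ 2) : ℝ) : ℂ) + z =
      ((c : ℝ) : ℂ) * ((V (t / c ^ 2) : ℂ) + z / ((c : ℝ) : ℂ)) := by
    push_cast
    rw [mul_add, mul_div_cancel₀ _ hcc]
  rw [hpt, loewnerInv_scale hV hc t him]

/-- **Hölder bounds transfer under scaling**: if `W = S_c V` and `f̂^V_{t/c²}` is Hölder-`r` with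
constant `C` on a set `S ⊇ A/c` (`A ⊆ ℍ`), then `f̂^W_t` is Hölder-`r` on `A` with constant
`c^{1-r} C` (`fHat_scale`). [cite: RohdeSchramm2005, Thm 5.2 (proof)] -/
theorem holderOnWith_fHat_of_scale (hV : Continuous V) {c : ℝ≥0} (hc : c ≠ 0)
    (hWV : W = fun s ↦ (c : ℝ) * V (s / c ^ 2)) (t : ℝ≥0) {C r : ℝ≥0} {S A : Set ℂ}
    (hA : A ⊆ upperHalfPlaneSet) (hAS : ∀ w ∈ A, w / ((c : ℝ) : ℂ) ∈ S)
    (hC : HolderOnWith C r (fHat V (t / c ^ 2)) S) :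
    HolderOnWith (Real.toNNReal ((c : ℝ) ^ (1 - (r : ℝ))) * C) r (fHat W t) A := by
  subst hWV
  have hc' : (0 : ℝ) < c := NNReal.coe_pos.2 (pos_iff_ne_zero.2 hc)
  apply holderOnWith_of_norm_sub_le
  intro z hz z' hz'
  have hzim : 0 < z.im := hA hz
  have hz'im : 0 < z'.im := hA hz'
  have h1 := hC.dist_le (hAS z hz) (hAS z' hz')
  rw [dist_eq_norm, dist_eq_norm, ← sub_div, norm_div, Complex.norm_real, Real.norm_eq_abs,
    abs_of_pos hc', Real.div_rpow (norm_nonneg _) hc'.le] at h1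
  rw [fHat_scale hV hc t hzim, fHat_scale hV hc t hz'im, ← mul_sub, norm_mul,
    Complex.norm_real, Real.norm_eq_abs, abs_of_pos hc', dist_eq_norm, NNReal.coe_mul,
    Real.coe_toNNReal _ (Real.rpow_nonneg hc'.le _)]
  have hce : (c : ℝ) / (c : ℝ) ^ (r : ℝ) = (c : ℝ) ^ (1 - (r : ℝ)) := by
    rw [Real.rpow_sub hc', Real.rpow_one]
  calc (c : ℝ) * ‖fHat V (t / c ^ 2) (z / ((c : ℝ) : ℂ)) - fHat V (t / c ^ 2) (z' / ((c : ℝ) : ℂ))‖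
      ≤ (c : ℝ) * (C * (‖z - z'‖ ^ (r : ℝ) / (c : ℝ) ^ (r : ℝ))) := by gcongr
    _ = (c : ℝ) / (c : ℝ) ^ (r : ℝ) * C * ‖z - z'‖ ^ (r : ℝ) := by ring
    _ = (c : ℝ) ^ (1 - (r : ℝ)) * C * ‖z - z'‖ ^ (r : ℝ) := by rw [hce]

end Loewner

/-! ### Assembly: Theorem 5.2 from Corollary 3.5 -/

section Assembly

variable {Ω : Type*} [MeasurableSpace Ω] {P : Measure Ω}

/-- **A.s. Hölder continuity of `f̂ₜ` on the box, `t ≤ 1`** (steps 2–4 of the printed proof): given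
Cor. 3.5 on `(Ω, P)` and `κ ∉ {0, 4}`, there is a grid exponent `e = 1 - h ∈ (0, 1)` (`e = 39/40`
for `κ ≥ 8`, `e = 1 - (κ - 4)²/(2(κ + 4)(κ + 12))` for `κ < 8`) such that for every Brownian
motion `B` with continuous paths and every `t ≤ 1`, almost surely `f̂ₜ` (driving function `√κ B`)
is Hölder continuous with exponent `1 - e` on `{|re z| ≤ 1, 0 < im z ≤ 1/2}` (a.s. grid bound
(5.4), Koebe distortion `norm_deriv_le_rpow_of_grid`, `holderOnWith_of_norm_deriv_le_rpow`).
[cite: RohdeSchramm2005, Thm 5.2 (proof)] -/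
theorem ae_exists_holderOnWith_box_of_cor35 (h35 : RohdeSchramm2005_cor35 P) {κ : ℝ≥0}
    (hκ : κ ≠ 0) (h4 : κ ≠ 4) :
    ∃ e : ℝ, 0 < e ∧ e < 1 ∧ ∀ (B : ℝ≥0 → Ω → ℝ), IsBrownianReal B P →
      (∀ ω, Continuous (B · ω)) → ∀ t : ℝ≥0, t ≤ 1 →
        ∀ᵐ ω ∂P, ∃ C : ℝ≥0, HolderOnWith C (Real.toNNReal (1 - e))
          (Loewner.fHat (fun s ↦ Real.sqrt κ * B s ω) t)
          {z : ℂ | |z.re| ≤ 1 ∧ 0 < z.im ∧ z.im ≤ 1 / 2} := by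
  -- the grid exponent `e = 1 - h` and the a.s. grid bound (5.4)
  have key : ∃ e : ℝ, 0 < e ∧ e < 1 ∧ ∀ (B : ℝ≥0 → Ω → ℝ), IsBrownianReal B P →
      (∀ ω, Continuous (B · ω)) → ∀ t : ℝ≥0, t ≤ 1 →
        ∀ᵐ ω ∂P, ∃ c : ℝ, ∀ (n : ℕ) (j : ℤ), |(j : ℝ)| ≤ (2 : ℕ) * 2 ^ n →
          ‖deriv (Loewner.fHat (fun s ↦ Real.sqrt κ * B s ω) t)
            (↑((j : ℝ) * ((2 : ℝ) ^ n)⁻¹) + I * ↑(((2 : ℝ) ^ n)⁻¹))‖ ≤ c * ((2 : ℝ) ^ n) ^ e := by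
    by_cases h8 : 8 ≤ κ
    · exact ⟨39 / 40, by norm_num, by norm_num, fun B hB hBc t ht ↦
        h35.ae_exists_grid_plane_of_le h8 hB hBc ht 2⟩
    · have hκR : (0 : ℝ) < κ := by exact_mod_cast pos_iff_ne_zero.2 hκ
      have h4R : (κ : ℝ) ≠ 4 := by exact_mod_cast h4
      have h12 : (κ : ℝ) < 12 := by
        have : (κ : ℝ) < 8 := by exact_mod_cast not_le.1 h8
        linarith
      obtain ⟨hh0, hh1⟩ := holderExp_quarter_pos_lt_one hκR h4R
      exact ⟨1 - ((κ : ℝ) - 4) ^ 2 / (2 * ((κ : ℝ) + 4) * ((κ : ℝ) + 12)), by linarith, by linarith,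
        fun B hB hBc t ht ↦ h35.ae_exists_grid_plane_of_lt hκ h4 h12 hB hBc ht 2⟩
  obtain ⟨e, he0, he1, hgrid⟩ := key
  refine ⟨e, he0, he1, fun B hB hBc t ht ↦ ?_⟩
  filter_upwards [hgrid B hB hBc t ht] with ω hω
  obtain ⟨c, hc⟩ := hω
  have hW : Continuous fun s ↦ Real.sqrt κ * B s ω := continuous_const.mul (hBc ω)
  have hf := Loewner.differentiableOn_fHat hW t
  have hinj := Loewner.injOn_fHat hW t
  have hc0 : 0 ≤ c := by
    have h00 := hc 0 0 (by simp)
    simp only [pow_zero, Real.one_rpow, mul_one] at h00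
    exact (norm_nonneg _).trans h00
  have hder : ∀ x y : ℝ, |x| ≤ 1 → 0 < y → y ≤ 1 →
      ‖deriv (Loewner.fHat (fun s ↦ Real.sqrt κ * B s ω) t) (x + y * I)‖ ≤
        12 ^ 4 * c * y ^ (-e) := fun x y hx hy0 hy1 ↦
    norm_deriv_le_rpow_of_grid hf hinj he0 (R := 2) hc (by push_cast; linarith) hy0 hy1
  exact ⟨_, holderOnWith_of_norm_deriv_le_rpow hf hinj he0.le he1 (by positivity) hder⟩

/-- **Rohde–Schramm's Theorem 5.2 from Corollary 3.5, on any probability space.** Given Cor. 3.5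
on `(Ω, P)` and `κ ∉ {0, 4}`, there is `h = h(κ) > 0` such that for every Brownian motion `B` with
continuous paths, every bounded `A ⊆ ℍ` and every `t`, almost surely `f̂ₜ` (driving function
`√κ B`) is Hölder-`h` on `A`. Step 1 of the printed proof ("By scaling, we may assume `0 < t ≤ 1`
and `A = [-1,1] × (0,1]`"): with `c = 2ᵐ > max{2 r_A, t + 1}`, `Bₘ = c⁻¹ B(c² ·)` is a Brownian
motion with continuous paths (Mathlib `IsBrownianReal.smul`), `√κ B = S_c(√κ Bₘ)`, `t/c² ≤ 1`,
`A/c` lies in the box, and `f̂ₜ = c f̂^{(m)}_{t/c²}(·/c)` (`Loewner.holderOnWith_fHat_of_scale`).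
[cite: RohdeSchramm2005, Thm 5.2] -/
theorem ae_exists_holderOnWith_fHat_of_cor35 (h35 : RohdeSchramm2005_cor35 P) {κ : ℝ≥0}
    (hκ : κ ≠ 0) (h4 : κ ≠ 4) :
    ∃ h : ℝ≥0, 0 < h ∧ ∀ (B : ℝ≥0 → Ω → ℝ), IsBrownianReal B P → (∀ ω, Continuous (B · ω)) →
      ∀ A : Set ℂ, Bornology.IsBounded A → A ⊆ upperHalfPlaneSet → ∀ t : ℝ≥0,
        ∀ᵐ ω ∂P, ∃ C : ℝ≥0, HolderOnWith C h (Loewner.fHat (fun s ↦ Real.sqrt κ * B s ω) t) A := by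
  obtain ⟨e, he0, he1, hbox⟩ := ae_exists_holderOnWith_box_of_cor35 h35 hκ h4
  refine ⟨Real.toNNReal (1 - e), Real.toNNReal_pos.2 (by linarith), fun B hB hBc A hA hAH t ↦ ?_⟩
  -- a radius for `A` and a dyadic scale `c = 2ᵐ` with `2 r_A < c` and `t + 1 < c`
  obtain ⟨rA, hrA⟩ := hA.subset_closedBall 0
  obtain ⟨m, hm⟩ := pow_unbounded_of_one_lt (max (2 * rA) ((t : ℝ) + 1)) one_lt_two
  set c : ℝ≥0 := 2 ^ m with hc
  have hc0 : c ≠ 0 := pow_ne_zero m two_ne_zero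
  have hcR : (c : ℝ) = (2 : ℝ) ^ m := by rw [hc]; push_cast; ring
  have hc' : (0 : ℝ) < c := by rw [hcR]; positivity
  have hcne : (c : ℝ) ≠ 0 := hc'.ne'
  have hc1 : (1 : ℝ) ≤ c := by rw [hcR]; exact one_le_pow₀ one_le_two
  have hrc : 2 * rA < c := by rw [hcR]; exact (le_max_left _ _).trans_lt hm
  have htc : (t : ℝ) + 1 < c := by rw [hcR]; exact (le_max_right _ _).trans_lt hm
  -- the rescaled Brownian motion `Bₘ = c⁻¹ B(c² ·)`
  set B' : ℝ≥0 → Ω → ℝ := fun s ω ↦ (√((c ^ 2 : ℝ≥0) : ℝ))⁻¹ * B (c ^ 2 * s) ω with hB'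
  have hB'BM : IsBrownianReal B' P := hB.smul (pow_ne_zero 2 hc0)
  have hB'c : ∀ ω, Continuous fun s ↦ B' s ω := fun ω ↦
    continuous_const.mul ((hBc ω).comp (continuous_const.mul continuous_id))
  have hsq : √((c ^ 2 : ℝ≥0) : ℝ) = (c : ℝ) := by
    push_cast
    exact Real.sqrt_sq c.2
  have ht' : t / c ^ 2 ≤ 1 := by
    rw [div_le_iff₀ (pow_pos (pos_iff_ne_zero.2 hc0) 2), one_mul]
    have h1 : (t : ℝ) ≤ (c : ℝ) ^ 2 := by nlinarith [mul_nonneg hc'.le (sub_nonneg.2 hc1)]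
    exact_mod_cast h1
  -- `A/c` lies in the box
  have hbox_mem : ∀ w ∈ A, w / ((c : ℝ) : ℂ) ∈ {z : ℂ | |z.re| ≤ 1 ∧ 0 < z.im ∧ z.im ≤ 1 / 2} := by
    intro w hw
    have hwn : ‖w‖ ≤ rA := mem_closedBall_zero_iff.1 (hrA hw)
    have hwc : ‖w / ((c : ℝ) : ℂ)‖ ≤ 1 / 2 := by
      rw [norm_div, Complex.norm_real, Real.norm_eq_abs, abs_of_pos hc', div_le_iff₀ hc']
      linarith
    refine ⟨(Complex.abs_re_le_norm _).trans (hwc.trans (by norm_num)), ?_, ?_⟩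
    · rw [Complex.div_ofReal_im]
      exact div_pos (hAH hw) hc'
    · exact le_trans (le_trans (le_abs_self _) (Complex.abs_im_le_norm _)) hwc
  filter_upwards [hbox B' hB'BM hB'c (t / c ^ 2) ht'] with ω hω
  obtain ⟨C, hC⟩ := hω
  have hVc : Continuous fun s ↦ Real.sqrt κ * B' s ω := continuous_const.mul (hB'c ω)
  have hWV : (fun s ↦ Real.sqrt κ * B s ω) =
      fun s ↦ (c : ℝ) * (Real.sqrt κ * B' (s / c ^ 2) ω) := by
    funext s
    simp only [hB']
    rw [hsq, mul_div_cancel₀ _ (pow_ne_zero 2 hc0)]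
    field_simp
  exact ⟨_, Loewner.holderOnWith_fHat_of_scale (V := fun s ↦ Real.sqrt κ * B' s ω) hVc hc0 hWV t
    hAH hbox_mem hC⟩

end Assembly

/-! ### The named fact -/

/-- **Rohde–Schramm (2005), Theorem 5.2, holds** (`RohdeSchramm2005_thm52`): for `κ ∉ {0, 4}`
there is `h = h(κ) > 0` such that for every bounded `A ⊆ ℍ` and every `t > 0`, for
`preWienerMeasure`-a.e. `ω`, `f̂ₜ = Loewner.fHat (sleDriving κ ω) t` is Hölder continuous with
exponent `h` on `A`. From Cor. 3.5 (proved: `RohdeSchramm2005_cor35_holds`) on the canonical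
space, where `sleDriving κ ω = √κ · brownian(ω)` and `brownian` is a Brownian motion with
continuous paths (`isBrownianReal_brownian'`), by `ae_exists_holderOnWith_fHat_of_cor35`
(the printed proof: scaling, (5.4) by Borel–Cantelli, Koebe distortion, integration along
hyperbolic geodesics). [cite: RohdeSchramm2005, Thm 5.2 (arXiv Thm 11)] -/
theorem RohdeSchramm2005_thm52_holds : RohdeSchramm2005_thm52 := by
  intro κ hκ h4
  obtain ⟨h, hh, H⟩ := ae_exists_holderOnWith_fHat_of_cor35
    (RohdeSchramm2005_cor35_holds Process.preWienerMeasure) hκ h4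
  exact ⟨h, hh, fun A hA hAH t _ ↦
    H Process.brownian isBrownianReal_brownian' Process.continuous_brownian A hA hAH t⟩

end Literature.Probability.RandomPlanarGeometry
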